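import Summits.ValiantsHypothesis.ValiantsHypothesis.Theses.DivisionGap
import Literature.Computability.AlgebraicComplexity.StandardFamilies
import Literature.Computability.AlgebraicComplexity.StrassenDivisionElimination

/-!
# Crux `DivisionGap.PerDivisionHard` (stmt-ValiantsHypothesis-5065, H1) is implied by the a.e. form
of `per ∉ VQP` — Strassen's division elimination, kernel version of the route's prose

The route file `Theses/DivisionGap.lean` records in prose that H1 (`PerDivisionHard`: every nonzero
cofactor `h ≥ 0` has `2^((log₂ n + c)^c) < L₊(per_n · h) + L₊(h)` eventually) is "a consequence of
the a.e. form of per ∉ VQP".  This helper (`--supports` stmt-ValiantsHypothesis-5065) makes that a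
theorem: `perDivisionHard_of_superQuasiPolyHard` — if
`∀ c, ∃ n₀, ∀ n ≥ n₀, 2^((log₂ n + c)^c) < L_ℂ(per_n)` then `PerDivisionHard`.
Mechanism as for `NN` (`FifoMatchingNNDivisionHardOfGeneralHardness.lean`, whose arithmetic is re-done here for `n²` variables so that this file stays inside its own route's cone): transport the monotone
certificate to `ℂ` (`complexity_map_le`, `map_perPoly`), remove the single division by
`DivisionElimination.complexity_le_pow_four_of_mul_eq` (`deg per_n = n`, `n²` variables), absorb
the overhead quasi-polynomially (`quasiPoly_absorb`, `C = c + 40`).  Contrapositive kill-link: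
`exists_quasiPoly_complexity_of_not_perDivisionHard`.

Honest framing: placement only; H1, per ∉ VP and VP ≠ VNP remain OPEN.  Sorry-free; axioms
`propext`, `Classical.choice`, `Quot.sound`.
-/

noncomputable section

-- Sub = Summit single-conjunct layout: the duplicated namespace component is mandated by the tree.
set_option linter.dupNamespace false

namespace Summit.ValiantsHypothesis.ValiantsHypothesis.Theorems.DivisionGap.PerDivisionHard.OfGeneralHardness

open MvPolynomial Literature.Computability.AlgebraicComplexity
open scoped NNReal BigOperators

/-! ### Arithmetic: the Strassen overhead is quasi-polynomial (`n²` variables) -/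

/-- `n + n² + 4 ≤ 2^(2 log₂ n + 5)` (from `n < 2^(log₂ n + 1)`). [folklore] -/
theorem poly_le_two_pow (n : ℕ) : n + n * n + 4 ≤ 2 ^ (2 * Nat.log 2 n + 5) := by
  have hn : n < 2 ^ (Nat.log 2 n + 1) := Nat.lt_pow_succ_log_self one_lt_two n
  set X := 2 ^ (Nat.log 2 n + 1) with hX
  have hX1 : 1 ≤ X := Nat.one_le_two_pow
  have h1 : n + n * n + 4 ≤ 6 * X ^ 2 := by nlinarith
  have h2 : 6 * X ^ 2 ≤ 8 * X ^ 2 := by nlinarith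
  have h3 : 8 * X ^ 2 = 2 ^ (2 * Nat.log 2 n + 5) := by
    rw [hX, ← pow_mul, show (8 : ℕ) = 2 ^ 3 by norm_num, ← pow_add]
    congr 1; ring
  omega

/-- With the logarithm abstracted: `n + n² + 4 ≤ 2^(2ℓ+5)` gives
`(2·2^E + n + n² + 4)⁴ ≤ 2^(4(E + 2ℓ + 7))`. [folklore] -/
theorem absorb_core (ℓ E n : ℕ) (hn : n + n * n + 4 ≤ 2 ^ (2 * ℓ + 5)) :
    (2 * 2 ^ E + n + n * n + 4) ^ 4 ≤ 2 ^ (4 * (E + 2 * ℓ + 7)) := by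
  have h1 : 2 * 2 ^ E = 2 ^ (E + 1) := by rw [pow_succ, mul_comm]
  have h3 : 2 ^ (E + 1) + 2 ^ (2 * ℓ + 5) ≤ 2 ^ (E + 1 + (2 * ℓ + 5) + 1) := by
    have ha : 2 ^ (E + 1) ≤ 2 ^ (E + 1 + (2 * ℓ + 5)) := Nat.pow_le_pow_right (by norm_num) (by omega)
    have hb : 2 ^ (2 * ℓ + 5) ≤ 2 ^ (E + 1 + (2 * ℓ + 5)) :=
      Nat.pow_le_pow_right (by norm_num) (by omega)
    rw [pow_succ]; omega
  have hbase : 2 * 2 ^ E + n + n * n + 4 ≤ 2 ^ (E + 1 + (2 * ℓ + 5) + 1) := by omega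
  have h4 : (2 ^ (E + 1 + (2 * ℓ + 5) + 1)) ^ 4 = 2 ^ (4 * (E + 2 * ℓ + 7)) := by
    rw [← pow_mul]
    congr 1
    ring
  calc (2 * 2 ^ E + n + n * n + 4) ^ 4 ≤ (2 ^ (E + 1 + (2 * ℓ + 5) + 1)) ^ 4 :=
        Nat.pow_le_pow_left hbase 4
    _ = 2 ^ (4 * (E + 2 * ℓ + 7)) := h4

/-- **Quasi-polynomial absorption** (`n²` variables): with `C = c + 40`,
`(2 · 2^((log₂ n + c)^c) + n + n² + 4)⁴ ≤ 2^((log₂ n + C)^C)`. [folklore] -/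
theorem quasiPoly_absorb (c n : ℕ) :
    (2 * 2 ^ ((Nat.log 2 n + c) ^ c) + n + n * n + 4) ^ 4 ≤
      2 ^ ((Nat.log 2 n + (c + 40)) ^ (c + 40)) := by
  have hA := absorb_core (Nat.log 2 n) ((Nat.log 2 n + c) ^ c) n (poly_le_two_pow n)
  -- exponent comparison `4(E + 2ℓ + 7) ≤ (ℓ + (c + 40))^(c + 40)`
  have hB : 4 * ((Nat.log 2 n + c) ^ c + 2 * Nat.log 2 n + 7) ≤
      (Nat.log 2 n + (c + 40)) ^ (c + 40) := by
    generalize Nat.log 2 n = ℓ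
    have hP : 1 ≤ (ℓ + c) ^ c := by
      rcases Nat.eq_zero_or_pos c with rfl | hc
      · simp
      · exact Nat.one_le_pow _ _ (by omega)
    have h1 : (ℓ + (c + 40)) ^ (c + 2) ≤ (ℓ + (c + 40)) ^ (c + 40) :=
      Nat.pow_le_pow_right (by omega) (by omega)
    have h2 : (ℓ + (c + 40)) ^ 2 * (ℓ + c) ^ c ≤ (ℓ + (c + 40)) ^ (c + 2) := by
      rw [pow_add, mul_comm]
      exact Nat.mul_le_mul_right _ (Nat.pow_le_pow_left (by omega) c)
    have h3a : 1600 + 80 * ℓ ≤ (ℓ + (c + 40)) ^ 2 := by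
      have e : (40 + ℓ) ^ 2 ≤ (ℓ + (c + 40)) ^ 2 := Nat.pow_le_pow_left (by omega) 2
      have e' : (40 + ℓ) ^ 2 = 1600 + 80 * ℓ + ℓ * ℓ := by ring
      omega
    have h3 : (1600 + 80 * ℓ) * (ℓ + c) ^ c ≤ (ℓ + (c + 40)) ^ 2 * (ℓ + c) ^ c :=
      Nat.mul_le_mul_right _ h3a
    generalize hPdef : (ℓ + c) ^ c = P at hP h3 ⊢
    have h4 : 4 * (P + 2 * ℓ + 7) ≤ (1600 + 80 * ℓ) * P := by
      have e1 : 80 * ℓ * 1 ≤ 80 * ℓ * P := Nat.mul_le_mul_left _ hP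
      have e2 : (1600 + 80 * ℓ) * P = 1600 * P + 80 * ℓ * P := by ring
      rw [e2]
      generalize 80 * ℓ * P = R at e1 ⊢
      omega
    rw [hPdef] at h2
    exact h4.trans (h3.trans (h2.trans h1))
  exact hA.trans (Nat.pow_le_pow_right (by norm_num) hB)

/-! ### The placement theorem -/

/-- **`per ∉ VQP` (a.e. form) implies `PerDivisionHard`** (Strassen's division elimination):
a certificate `L₊(per_n h) + L₊(h) ≤ 2^((log₂ n + c)^c)` over `ℝ≥0` yields complex circuits for
`per_n · h` and `h ≠ 0`, hence `L_ℂ(per_n) ≤ (2Q + n + n² + 4)⁴ ≤ 2^((log₂ n + c + 40)^(c + 40))`.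
[folklore] -/
theorem perDivisionHard_of_superQuasiPolyHard
    (H : ∀ c : ℕ, ∃ n₀ : ℕ, ∀ n ≥ n₀, 2 ^ ((Nat.log 2 n + c) ^ c) <
      complexity (perPoly (Fin n) ℂ)) :
    Summit.ValiantsHypothesis.ValiantsHypothesis.Theses.DivisionGap.PerDivisionHard := by
  intro c
  obtain ⟨n₀, hn₀⟩ := H (c + 40)
  refine ⟨n₀, fun n hn hh hh0 => ?_⟩
  have hlt : 2 ^ ((Nat.log 2 n + (c + 40)) ^ (c + 40)) < complexity (perPoly (Fin n) ℂ) :=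
    hn₀ n hn
  by_contra hle
  push Not at hle
  set φ : ℝ≥0 →+* ℂ := Complex.ofRealHom.comp NNReal.toRealHom with hφ
  have hφinj : Function.Injective φ := by
    intro x y hxy
    have h1 : ((x : ℝ) : ℂ) = ((y : ℝ) : ℂ) := hxy
    exact_mod_cast h1
  have hmaph : MvPolynomial.map φ hh ≠ 0 := by
    intro h0
    apply hh0
    apply MvPolynomial.map_injective φ hφinj
    rw [h0, map_zero]
  have hprod : perPoly (Fin n) ℂ * MvPolynomial.map φ hh =
      MvPolynomial.map φ (perPoly (Fin n) ℝ≥0 * hh) := by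
    rw [map_mul, map_perPoly]
  have hdeg : (perPoly (Fin n) ℂ).totalDegree ≤ n := by
    have h := (perPoly_isHomogeneous (n := Fin n) (k := ℂ)).totalDegree_le
    simpa [Fintype.card_fin] using h
  have hS := DivisionElimination.complexity_le_pow_four_of_mul_eq hprod hmaph hdeg
  have c1 : complexity (MvPolynomial.map φ (perPoly (Fin n) ℝ≥0 * hh)) ≤
      complexity (perPoly (Fin n) ℝ≥0 * hh) := ArithCircuit.complexity_map_le φ _
  have c2 : complexity (MvPolynomial.map φ hh) ≤ complexity hh := ArithCircuit.complexity_map_le φ _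
  have hcard : Fintype.card (Fin n × Fin n) = n * n := by
    rw [Fintype.card_prod, Fintype.card_fin]
  rw [hcard] at hS
  have hsum : complexity (MvPolynomial.map φ (perPoly (Fin n) ℝ≥0 * hh)) +
      complexity (MvPolynomial.map φ hh) + n + n * n + 4 ≤
      2 * 2 ^ ((Nat.log 2 n + c) ^ c) + n + n * n + 4 := by omega
  have hbound : complexity (perPoly (Fin n) ℂ) ≤ 2 ^ ((Nat.log 2 n + (c + 40)) ^ (c + 40)) :=
    hS.trans ((Nat.pow_le_pow_left hsum 4).trans (quasiPoly_absorb c n))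
  exact absurd (lt_of_lt_of_le hlt hbound) (lt_irrefl _)

/-- **Kill-link (contrapositive)**: a refutation of `PerDivisionHard` gives quasi-polynomial
complex circuits for `per_n` along infinitely many `n` (the a.e. form of `per ∉ VQP` fails).
[folklore] -/
theorem exists_quasiPoly_complexity_of_not_perDivisionHard
    (hneg : ¬ Summit.ValiantsHypothesis.ValiantsHypothesis.Theses.DivisionGap.PerDivisionHard) :
    ∃ C : ℕ, ∀ n₀ : ℕ, ∃ n ≥ n₀, complexity (perPoly (Fin n) ℂ) ≤ 2 ^ ((Nat.log 2 n + C) ^ C) := by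
  by_contra hall
  push Not at hall
  exact hneg (perDivisionHard_of_superQuasiPolyHard fun C => hall C)

end Summit.ValiantsHypothesis.ValiantsHypothesis.Theorems.DivisionGap.PerDivisionHard.OfGeneralHardness

end
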